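import Summits.KontsevichZagierPeriods.KontsevichZagierPeriods.Theorems.LogPrimitiveNL.Negative.LoadBearing
import Literature.Barriers.KontsevichZagierPeriods.AlgebraicPrimitivesObstruction

/-!
# Crux `LiouvilleUnfolding.LogPrimitiveNL` (stmt-KontsevichZagierPeriods-2836): a bare form and a false strengthening

Negative-side (cdisprove) support, file 3/3.

* `Bare` — the crux with ALL of `ha hb hh hV hint` (semialgebraicity of `a, b, hᵢ, Vᵢ`, termwise
  integrability) dropped — still follows from the kernel conjecture and from the summit
  (`bare_of_kzKernelConjecture`, `bare_of_summit`, `crux_of_bare`): these hypotheses serve the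
  CONSTRUCTION of a derivation (intermediate representations must be `KZ.IntegralRep`s), not the
  truth of the conclusion, and no counterexample to the crux can come from them.
* `negV_of_crux` — the sign in `hpos` is immaterial (`V ↦ −V`).
* `SingleMove` — the strengthening "the logarithmic step is ONE honest Newton–Leibniz move" (a
  `ℚ`-semialgebraic primitive exists on the band) implies the crux (`crux_of_singleMove`) and is
  FALSE (`not_singleMove`): the kernel element `2t/(2 − t²) − 1/(2 − t)` of the barrier
  `Literature.Barriers.KontsevichZagierPeriods.KZ.algebraicPrimitivesObstructionNarrow` is a valid
  instance of the crux (`n = 0`, `k = 2`, `V = (2 − t², 2 − t)`, `h = (−1, 1)`, boundary term `0`)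
  with no semialgebraic primitive on `[0, 1]`. Any proof must change dimension or use rule 2).
-/

noncomputable section

open Set MeasureTheory
open Literature.NumberTheory.Transcendental

namespace Summit.KontsevichZagierPeriods.LiouvilleUnfolding.LogPrimitiveNL.Negative

open Summit.KontsevichZagierPeriods.KontsevichZagierPeriods.Theses.LiouvilleUnfolding (LogPrimitiveNL)

/-! ## §5 NOT load-bearing modulo Conjecture 1: the semialgebraicity of `a, b, hᵢ, Vᵢ` and termwise integrability

`Bare` drops ALL of `ha hb hh hV hint` at once (keeping `a ≤ b`, the band equation, `Vᵢ > 0`,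
continuity, the derivative and the two integrand equations). It is still a consequence of the kernel
conjecture, hence of the summit: the dropped hypotheses are not needed for the TRUTH of the
conclusion, only (presumably) for CONSTRUCTING a derivation — every intermediate representation of
the unfolding plan must itself be a `KZ.IntegralRep` (semialgebraic, absolutely integrable). A
counterexample to `Bare` would refute Conjecture 1. -/

/-- The crux with `ha hb hh hV hint` ALL dropped: only the analytic data remain. -/
def Bare : Prop :=
  ∀ (n k : ℕ) (r : KZ.IntegralRep (n + 1)) (r' : KZ.IntegralRep n) (a b : (Fin n → ℝ) → ℝ)
    (h : Fin k → (Fin n → ℝ) → ℝ) (V V' : Fin k → (Fin (n + 1) → ℝ) → ℝ),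
    (∀ x ∈ r'.domain, a x ≤ b x) →
    r.domain = {z | (Fin.init z : Fin n → ℝ) ∈ r'.domain ∧ a (Fin.init z) ≤ z (Fin.last n) ∧
      z (Fin.last n) ≤ b (Fin.init z)} →
    (∀ i, ∀ z ∈ r.domain, 0 < V i z) →
    (∀ i, ∀ x ∈ r'.domain, ContinuousOn (fun t : ℝ => V i (Fin.snoc x t)) (Icc (a x) (b x))) →
    (∀ i, ∀ x ∈ r'.domain, ∀ t ∈ Ioo (a x) (b x),
      HasDerivAt (fun s : ℝ => V i (Fin.snoc x s)) (V' i (Fin.snoc x t)) t) →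
    (∀ x ∈ r'.domain, ∀ t ∈ Ioo (a x) (b x),
      r.integrand (Fin.snoc x t) = ∑ i, h i x * V' i (Fin.snoc x t) / V i (Fin.snoc x t)) →
    (∀ x ∈ r'.domain, r'.integrand x =
      ∑ i, h i x * (Real.log (V i (Fin.snoc x (b x))) - Real.log (V i (Fin.snoc x (a x))))) →
    KZ.of r - KZ.of r' ∈ KZ.relations

/-- `Bare` follows from the kernel conjecture (`eval_sub_eq_zero_of_logData` uses none of the dropped
hypotheses). -/
theorem bare_of_kzKernelConjecture (hK : KZKernelConjecture) : Bare := by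
  intro n k r r' a b h V V' hab hdom hpos hcont hderiv hr hr'
  exact hK _ (eval_sub_eq_zero_of_logData r r' a b h V V' hab hdom hpos hcont hderiv hr hr')

/-- `Bare` follows from the summit. -/
theorem bare_of_summit (hS : _root_.KontsevichZagierPeriods) : Bare :=
  bare_of_kzKernelConjecture (kzKernelConjecture_iff_isRational.mpr hS)

/-- `Bare` is a strengthening of the crux. -/
theorem crux_of_bare (hB : Bare) : LogPrimitiveNL := by
  intro n k r r' a b h V V' _ _ hab hdom _ _ hpos hcont hderiv _ hr hr'
  exact hB n k r r' a b h V V' hab hdom hpos hcont hderiv hr hr'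

/-! ### §5b The sign in `hpos` is immaterial -/

/-- The crux with `0 < Vᵢ` replaced by `Vᵢ < 0` on the band. -/
def NegV : Prop :=
  ∀ (n k : ℕ) (r : KZ.IntegralRep (n + 1)) (r' : KZ.IntegralRep n) (a b : (Fin n → ℝ) → ℝ)
    (h : Fin k → (Fin n → ℝ) → ℝ) (V V' : Fin k → (Fin (n + 1) → ℝ) → ℝ),
    IsSemialgebraicFunOn ℚ r'.domain a →
    IsSemialgebraicFunOn ℚ r'.domain b →
    (∀ x ∈ r'.domain, a x ≤ b x) →
    r.domain = {z | (Fin.init z : Fin n → ℝ) ∈ r'.domain ∧ a (Fin.init z) ≤ z (Fin.last n) ∧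
      z (Fin.last n) ≤ b (Fin.init z)} →
    (∀ i, IsSemialgebraicFunOn ℚ r'.domain (h i)) →
    (∀ i, IsSemialgebraicFunOn ℚ r.domain (V i)) →
    (∀ i, ∀ z ∈ r.domain, V i z < 0) →
    (∀ i, ∀ x ∈ r'.domain, ContinuousOn (fun t : ℝ => V i (Fin.snoc x t)) (Icc (a x) (b x))) →
    (∀ i, ∀ x ∈ r'.domain, ∀ t ∈ Ioo (a x) (b x),
      HasDerivAt (fun s : ℝ => V i (Fin.snoc x s)) (V' i (Fin.snoc x t)) t) →
    (∀ i, IntegrableOn (fun z => h i (Fin.init z) * V' i z / V i z) r.domain) →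
    (∀ x ∈ r'.domain, ∀ t ∈ Ioo (a x) (b x),
      r.integrand (Fin.snoc x t) = ∑ i, h i x * V' i (Fin.snoc x t) / V i (Fin.snoc x t)) →
    (∀ x ∈ r'.domain, r'.integrand x =
      ∑ i, h i x * (Real.log (V i (Fin.snoc x (b x))) - Real.log (V i (Fin.snoc x (a x))))) →
    KZ.of r - KZ.of r' ∈ KZ.relations

/-- **The crux implies its negative-sign twin** (`V ↦ −V`, `V' ↦ −V'`; `Real.log (−v) = Real.log v`,
`h(−V')/(−V) = hV'/V`): only `Vᵢ ≠ 0` on the closed fibres carries content in `hpos`. (Zeros of a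
semialgebraic `Vᵢ` inside a fibre with `hᵢ(x) ≠ 0` are excluded anyway by `hint`: near a zero of
order `α > 0`, `Vᵢ'/Vᵢ ~ α/(t − t₀)` is not integrable.) -/
theorem negV_of_crux (hc : LogPrimitiveNL) : NegV := by
  intro n k r r' a b h V V' ha hb hab hdom hh hV hneg hcont hderiv hint hr hr'
  have hfun : ∀ i, (fun z : Fin (n + 1) → ℝ => h i (Fin.init z) * -V' i z / -V i z) =
      fun z => h i (Fin.init z) * V' i z / V i z :=
    fun i => funext fun z => by rw [mul_neg, neg_div_neg_eq]
  refine hc n k r r' a b h (fun i z => -V i z) (fun i z => -V' i z) ha hb hab hdom hh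
    (fun i => ?_) (fun i z hz => neg_pos.2 (hneg i z hz)) (fun i x hx => (hcont i x hx).neg)
    (fun i x hx t ht => (hderiv i x hx t ht).neg) (fun i => ?_) (fun x hx t ht => ?_) (fun x hx => ?_)
  · show IsSemialgebraicFunOn ℚ r.domain (fun z => -V i z)
    exact (hV i).neg
  · show IntegrableOn (fun z : Fin (n + 1) → ℝ => h i (Fin.init z) * -V' i z / -V i z) r.domain
    rw [hfun i]
    exact hint i
  · rw [hr x hx t ht]
    exact Finset.sum_congr rfl fun i _ => by rw [mul_neg, neg_div_neg_eq]
  · simp only [Real.log_neg_eq_log]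
    exact hr' x hx

/-! ## §6 A natural strengthening that IS false: the logarithmic step is not ONE Newton–Leibniz move

`SingleMove`: same hypotheses, conclusion "there is a `ℚ`-semialgebraic primitive `F` on the band
realising `[r] − [r']` as ONE instance of `KZ.newtonLeibnizRel`". It implies the crux
(`crux_of_singleMove`) and it is FALSE (`not_singleMove`): the kernel element
`f(t) = 2t/(2 − t²) − 1/(2 − t)` of the NARROW barrier
`Literature.Barriers.KontsevichZagierPeriods.KZ.algebraicPrimitivesObstructionNarrow` IS an instance of
the crux — `n = 0`, band `[0, 1]`, `k = 2`, `V₀ = 2 − t²` (`h₀ = −1`), `V₁ = 2 − t` (`h₁ = 1`), boundary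
term `(−1)(log 1 − log 2) + (log 1 − log 2) = 0`, `r' = [pt, 0]` — and it has no `ℚ`-semialgebraic
primitive on `[0, 1]` (`algebraicPrimitivesObstructionNarrow_holds`, with `c = 0`). So any proof of
the crux must CHANGE DIMENSION or use change of variables (here: `[[0,1], 1/(2−t)] ~ [[0,1], 2t/(2−t²)]`
is one move of rule 2), `t ↦ t²`), exactly as the route's unfolding plan does; "Newton–Leibniz with a
cleverer semialgebraic primitive" is excluded already at `n = 0`, `k = 2`. -/

/-- STRENGTHENING of the crux: the logarithmic Newton–Leibniz datum is ONE honest Newton–Leibniz move,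
i.e. admits a `ℚ`-semialgebraic primitive on the band with the right boundary values. -/
def SingleMove : Prop :=
  ∀ (n k : ℕ) (r : KZ.IntegralRep (n + 1)) (r' : KZ.IntegralRep n) (a b : (Fin n → ℝ) → ℝ)
    (h : Fin k → (Fin n → ℝ) → ℝ) (V V' : Fin k → (Fin (n + 1) → ℝ) → ℝ),
    IsSemialgebraicFunOn ℚ r'.domain a →
    IsSemialgebraicFunOn ℚ r'.domain b →
    (∀ x ∈ r'.domain, a x ≤ b x) →
    r.domain = {z | (Fin.init z : Fin n → ℝ) ∈ r'.domain ∧ a (Fin.init z) ≤ z (Fin.last n) ∧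
      z (Fin.last n) ≤ b (Fin.init z)} →
    (∀ i, IsSemialgebraicFunOn ℚ r'.domain (h i)) →
    (∀ i, IsSemialgebraicFunOn ℚ r.domain (V i)) →
    (∀ i, ∀ z ∈ r.domain, 0 < V i z) →
    (∀ i, ∀ x ∈ r'.domain, ContinuousOn (fun t : ℝ => V i (Fin.snoc x t)) (Icc (a x) (b x))) →
    (∀ i, ∀ x ∈ r'.domain, ∀ t ∈ Ioo (a x) (b x),
      HasDerivAt (fun s : ℝ => V i (Fin.snoc x s)) (V' i (Fin.snoc x t)) t) →
    (∀ i, IntegrableOn (fun z => h i (Fin.init z) * V' i z / V i z) r.domain) →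
    (∀ x ∈ r'.domain, ∀ t ∈ Ioo (a x) (b x),
      r.integrand (Fin.snoc x t) = ∑ i, h i x * V' i (Fin.snoc x t) / V i (Fin.snoc x t)) →
    (∀ x ∈ r'.domain, r'.integrand x =
      ∑ i, h i x * (Real.log (V i (Fin.snoc x (b x))) - Real.log (V i (Fin.snoc x (a x))))) →
    ∃ F : (Fin (n + 1) → ℝ) → ℝ, IsSemialgebraicFunOn ℚ r.domain F ∧
      (∀ x ∈ r'.domain, ContinuousOn (fun t : ℝ => F (Fin.snoc x t)) (Icc (a x) (b x))) ∧
      (∀ x ∈ r'.domain, ∀ t ∈ Ioo (a x) (b x),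
        HasDerivAt (fun s : ℝ => F (Fin.snoc x s)) (r.integrand (Fin.snoc x t)) t) ∧
      ∀ x ∈ r'.domain, r'.integrand x = F (Fin.snoc x (b x)) - F (Fin.snoc x (a x))

/-- `SingleMove` implies the crux: the primitive `F` makes `[r] − [r']` an element of
`KZ.newtonLeibnizRel ⊆ KZ.relations`. -/
theorem crux_of_singleMove (hS : SingleMove) : LogPrimitiveNL := by
  intro n k r r' a b h V V' ha hb hab hdom hh hV hpos hcont hderiv hint hr hr'
  obtain ⟨F, hF, hFc, hFd, hFr'⟩ :=
    hS n k r r' a b h V V' ha hb hab hdom hh hV hpos hcont hderiv hint hr hr'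
  exact KZ.newtonLeibnizRel_subset_relations
    ⟨n, r, r', a, b, F, hF, ha, hb, hab, hdom, hFc, hFd, hFr', rfl⟩

section SingleMoveWitness

open Literature.ModelTheory.ExponentialFields (isSemialgebraic_univ)

/-- The barrier's kernel element as a representation: `[[0, 1], 2t/(2 − t²) − 1/(2 − t)]`. -/
def kerRep : KZ.IntegralRep 1 :=
  bandRep 0 1 isSemialgebraic_band1_zero_one
    (fun z => 2 * z 0 / (2 - z 0 ^ 2) - 1 / (2 - z 0))
    ((isSemialgebraicFunOn_aeval_div_aeval isSemialgebraic_band1_zero_one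
        (2 * MvPolynomial.X 0 * (2 - MvPolynomial.X 0) - (2 - MvPolynomial.X 0 ^ 2))
        ((2 - MvPolynomial.X 0 ^ 2) * (2 - MvPolynomial.X 0)) fun z hz => by
          have h0 := (mem_band1.1 hz).1
          have h1 := (mem_band1.1 hz).2
          simp only [map_mul, map_sub, map_pow, MvPolynomial.aeval_X, map_ofNat]
          apply mul_ne_zero <;> nlinarith).congr
      fun z hz => by
        have h0 := (mem_band1.1 hz).1
        have h1 := (mem_band1.1 hz).2
        have h2 : (2 : ℝ) - z 0 ^ 2 ≠ 0 := by nlinarith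
        have h3 : (2 : ℝ) - z 0 ≠ 0 := by intro h; nlinarith
        simp only [map_mul, map_sub, map_pow, MvPolynomial.aeval_X, map_ofNat]
        field_simp)
    (by
      refine ContinuousOn.sub ?_ ?_
      · exact (continuousOn_const.mul (continuous_apply 0).continuousOn).div
          (continuousOn_const.sub ((continuous_apply 0).continuousOn.pow 2))
          fun z hz => by
            have h0 := (mem_band1.1 hz).1
            have h1 := (mem_band1.1 hz).2
            nlinarith
      · exact continuousOn_const.div (continuousOn_const.sub (continuous_apply 0).continuousOn)
          fun z hz => by
            have h1 := (mem_band1.1 hz).2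
            intro h; nlinarith)

/-- `band1 a b` in the barrier's format `{x | x₀ ∈ [a, b]}`. -/
theorem band1_eq_setOf (a b : ℝ) : band1 a b = {x : Fin 1 → ℝ | x 0 ∈ Icc a b} := by
  ext z
  simp [mem_band1]

/-- Over the point, `Fin.snoc x s` is the constant tuple `s`. -/
theorem snoc_eq_const (x : Fin 0 → ℝ) (s : ℝ) : (Fin.snoc x s : Fin 1 → ℝ) = fun _ => s := by
  funext i
  rw [Fin.fin_one_eq_zero i]
  exact snoc_fin_one_apply_zero x s

/-- **The single-move strengthening is FALSE** (the barrier's kernel element is a crux instance with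
no semialgebraic primitive). -/
theorem not_singleMove : ¬ SingleMove := by
  intro H
  obtain ⟨F, hF, -, hFd, -⟩ := H 0 2 kerRep (ptRep 0) (fun _ => 0) (fun _ => 1)
    ![fun _ => -1, fun _ => 1]
    ![fun z => 2 - z 0 ^ 2, fun z => 2 - z 0] ![fun z => -2 * z 0, fun _ => -1]
    ((isSemialgebraicFunOn_const isSemialgebraic_univ 0).congr fun _ _ => by simp)
    ((isSemialgebraicFunOn_const isSemialgebraic_univ 1).congr fun _ _ => by simp)
    (fun _ _ => zero_le_one)
    rfl
    (by
      refine Fin.forall_fin_two.2 ⟨?_, ?_⟩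
      · exact (isSemialgebraicFunOn_const isSemialgebraic_univ (-1)).congr fun _ _ => by simp
      · exact (isSemialgebraicFunOn_const isSemialgebraic_univ 1).congr fun _ _ => by simp)
    (by
      refine Fin.forall_fin_two.2 ⟨?_, ?_⟩
      · show IsSemialgebraicFunOn ℚ (band1 0 1) (fun z : Fin 1 → ℝ => 2 - z 0 ^ 2)
        exact (isSemialgebraicFunOn_aeval isSemialgebraic_band1_zero_one
          (2 - MvPolynomial.X 0 ^ 2 : MvPolynomial (Fin 1) ℚ)).congr fun z _ => by simp
      · show IsSemialgebraicFunOn ℚ (band1 0 1) (fun z : Fin 1 → ℝ => 2 - z 0)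
        exact (isSemialgebraicFunOn_aeval isSemialgebraic_band1_zero_one
          (2 - MvPolynomial.X 0 : MvPolynomial (Fin 1) ℚ)).congr fun z _ => by simp)
    (by
      refine Fin.forall_fin_two.2 ⟨fun z hz => ?_, fun z hz => ?_⟩
      · have h0 := (mem_band1.1 hz).1
        have h1 := (mem_band1.1 hz).2
        show (0 : ℝ) < 2 - z 0 ^ 2
        nlinarith
      · have h1 := (mem_band1.1 hz).2
        show (0 : ℝ) < 2 - z 0
        linarith)
    (by
      refine Fin.forall_fin_two.2 ⟨fun x _ => ?_, fun x _ => ?_⟩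
      · show ContinuousOn (fun t : ℝ => 2 - (Fin.snoc x t : Fin 1 → ℝ) 0 ^ 2) (Icc 0 1)
        simp only [snoc_fin_one_apply_zero]
        exact continuousOn_const.sub (continuousOn_id.pow 2)
      · show ContinuousOn (fun t : ℝ => 2 - (Fin.snoc x t : Fin 1 → ℝ) 0) (Icc 0 1)
        simp only [snoc_fin_one_apply_zero]
        exact continuousOn_const.sub continuousOn_id)
    (by
      refine Fin.forall_fin_two.2 ⟨fun x _ t _ => ?_, fun x _ t _ => ?_⟩
      · show HasDerivAt (fun s : ℝ => 2 - (Fin.snoc x s : Fin 1 → ℝ) 0 ^ 2)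
          (-2 * (Fin.snoc x t : Fin 1 → ℝ) 0) t
        simp only [snoc_fin_one_apply_zero]
        exact ((hasDerivAt_pow 2 t).const_sub (2 : ℝ)).congr_deriv (by ring)
      · show HasDerivAt (fun s : ℝ => 2 - (Fin.snoc x s : Fin 1 → ℝ) 0) (-1) t
        simp only [snoc_fin_one_apply_zero]
        exact (hasDerivAt_id' t).const_sub (2 : ℝ))
    (by
      refine Fin.forall_fin_two.2 ⟨?_, ?_⟩
      · have hc : ContinuousOn (fun z : Fin 1 → ℝ => (-1 : ℝ) * (-2 * z 0) / (2 - z 0 ^ 2))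
            (band1 0 1) :=
          (continuousOn_const.mul (continuousOn_const.mul (continuous_apply 0).continuousOn)).div
            (continuousOn_const.sub ((continuous_apply 0).continuousOn.pow 2))
            fun z hz => by
              have h0 := (mem_band1.1 hz).1
              have h1 := (mem_band1.1 hz).2
              nlinarith
        show IntegrableOn (fun z : Fin 1 → ℝ => (-1 : ℝ) * (-2 * z 0) / (2 - z 0 ^ 2)) (band1 0 1)
        exact hc.integrableOn_compact (isCompact_band1 0 1)
      · have hc : ContinuousOn (fun z : Fin 1 → ℝ => (1 : ℝ) * (-1) / (2 - z 0)) (band1 0 1) :=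
          continuousOn_const.div (continuousOn_const.sub (continuous_apply 0).continuousOn)
            fun z hz => by
              have h1 := (mem_band1.1 hz).2
              intro h; nlinarith
        show IntegrableOn (fun z : Fin 1 → ℝ => (1 : ℝ) * (-1) / (2 - z 0)) (band1 0 1)
        exact hc.integrableOn_compact (isCompact_band1 0 1))
    (fun x _ t ht => by
      simp only [mem_Ioo] at ht
      have h2 : (2 : ℝ) - t ^ 2 ≠ 0 := by nlinarith
      have h3 : (2 : ℝ) - t ≠ 0 := by intro h; nlinarith
      simp only [kerRep, integrand_bandRep, snoc_fin_one_apply_zero, Fin.sum_univ_two,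
        Matrix.cons_val_zero, Matrix.cons_val_one]
      field_simp
      ring)
    (fun x _ => by
      norm_num [Fin.sum_univ_two])
  -- the primitive `F` contradicts the barrier (with `c = 0`)
  refine Literature.Barriers.KontsevichZagierPeriods.KZ.algebraicPrimitivesObstructionNarrow_holds
    ⟨0, F, ?_, fun t ht => ?_⟩
  · have hF' : IsSemialgebraicFunOn ℚ (band1 (0 : ℝ) 1) F := hF
    rwa [band1_eq_setOf] at hF'
  · have hd := hFd (fun i => i.elim0) (mem_univ _) t ht
    rw [snoc_eq_const] at hd
    simp only [kerRep, integrand_bandRep] at hd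
    refine hd.congr_deriv ?_
    simp only [add_zero]

end SingleMoveWitness


end Summit.KontsevichZagierPeriods.LiouvilleUnfolding.LogPrimitiveNL.Negative
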